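import Summits.QuantumFields.BalabanUV.Beta.SecondOrderSplitLoc
import Summits.QuantumFields.BalabanUV.Beta.SymShiftedSpread
import Summits.QuantumFields.BalabanUV.Beta.E3ContactGenerator
import Summits.QuantumFields.BalabanUV.Beta.DshAn1Spread
import Summits.QuantumFields.BalabanUV.Beta.RelInvNullShift
import Summits.QuantumFields.BalabanUV.Beta.MultiplierTableSlot
import Summits.QuantumFields.BalabanUV.Beta.SymSecondOrderTablesAn1

/-!
# `BalabanUV.Beta.SymSecondOrderSplitLoc` — binder row D1, hR side of the (0.4) ROOT: **THE LOCALISATION BINDER (hDg) OF THE LITERAL ROOT IS A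
# THEOREM** — `Loc (dM G_j Lc S♯_j M_j ν y′)` for the ♯-table `S♯_j κ u := SpureRec_j κ u + conjV (bhKStepSh_j) (diagK (γ_j·E_{κu}))` of the
# (0.4)-symmetrised literal, EVERY level `j`, axis `α`, bond `(ν, y′)`, any `γ`, any `cΛ`; and the bounded ∕ `LocStencil₂` CLASSES of its second symbol `h2`
# (β sub-cell, D1 formalisation swarm, unit `b2b-balaban-beta-d1-formalise-leaf-03`, gen 17; the sym twin of leaf-10 g2's comb-literal socket
# `SecondOrderSplitLiteral.loc_dM_sharp_literal`, for the row-D1 OWNER an2's ROOT J `RowD1JointEndSymReflTablesAn1S2MWVB` (p299091), binder `hDg`)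

NOT IN PRINT; OUR BOOKKEEPING.  HONEST FRAMING (cell contract, verbatim): «discharging `BetaPertH` makes Bałaban's UV stability
UNCONDITIONAL — a real constructive-QFT result; it is NOT the continuum limit and NOT the Clay problem.»  HONEST DEPENDENCY (verbatim):
«continuum YM on T⁴ ⇐ BetaPertH ∧ nine spine estimates (0/9 proved); BetaPertH ⇐ (D1) ∧ (D4) ∧ CAP+tail; G-an2-4 gates asym, D1 and
NE2/3/4.»  [folklore] analysis bookkeeping (exponential localisation of absolutely convergent lattice sums) over OUR objects; instantiates NO binder
of the β-function wall by itself; no `[cite:]`, no `def`, no `def … : Prop`; NOT D1, NOT `BetaPertH`, NOT continuum, NOT Clay.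

## What

ROOT J of row D1 (`RowD1JointEndSymReflTablesAn1S2MWVB.d1Drift_JsB12Sym_an1TablesS2_of_level0ReflLetter_split_D1Tel_D1Rep_of_locks`, tree l.124–125)
displays, among its hR-side data, the localisation
`(hDg : ∀ (j : ℕ) (α ν : Fin 4) (y' : Fin 4 → ℤ), Loc (dM (Gsym Lc j) Lc (fun κ u => SpureRecOf 3 Lc (symVhSAt (ctr 4 Lc) 3 Lc rfl) (symHessFFAt (ctr 4 Lc) Lc)
  (Gsym Lc) (Lc^4) (−Lc^8∕2) cΛ j κ u + conjV (bhKStepSh 3 Lc (Dsh Lc) j) (diagK fun p c => γ j * ctGenM 3 (bhK Lc + Dsh Lc) α Lc κ u p c))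
  (M1Of 3 Lc (symHessFFAt (ctr 4 Lc) Lc) cΛ j) ν y'))`.
Unlike its neighbours `hX2L`, `hΔL` (which concern the FREE tables `X2s`, `Δ`), it concerns FIXED objects only, and every class it needs is already a
theorem of the tree: (DG) `SymmetrisedStepJets.decays_Gsym`, the shifted spread `SymShiftedSpread.spr_bhKStepSh` over (Dspr) `DshAn1.spr_Dsh`, the
border `bhK + Dsh` spread (`BorderedHessian.spr_bhK`, `RelInvNullShift.spr_add`), the generator family's bi-localisation
`E3ContactGenerator.locStencil_diagK_ctGenM`, the recursive pure stencils `SpineRooted.locStencil_SpureRecOf` over (LV)(LH)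
`SymAveragingHessianCounts.symVhSAt_hV_ctr ∕ symHessFFAt_hH_ctr`, the multiplier tables `SpineRooted.vertexFamily_M1Of`, and leaf-10's generic socket
`SecondOrderSplitLoc.loc_dM_sharp` at one common rate.

* §1 `locStencil_diagK_mul_ctGenM` — the `γ`-scaled generator family `κ u ↦ diagK (p a ↦ c·ctGenM d B α L κ u p a)` over ANY decaying border `B` is a
  local stencil family (the `c * ·` spelling the roots display; `VertexReflectionContact.smul_diagK` + `StepJetData.biLoc_smul`).
* §2 **`loc_dM_sharp_of_classes`** — (hDg) in EXISTENTIAL currency for ANY spread `K`, `𝕄`, `B`, any local stencil family `S`, any vertex family `M`,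
  any scalar `c` (rates matched once, here).
* §3 **`loc_dM_sharp_sym`** — the (0.4) literal over ANY first-order tables `(V, H)` of classes (LV)(LH) and ANY spread shift `D`:
  `K := Gsym Lc j`, `𝕄 := bhKStepSh d Lc D j`, `B := bhK Lc + D`, `S := SpureRecOf d Lc V H (Gsym Lc) cE cVH cΛ j`, `M := M1Of d Lc H cΛ j`;
  `loc_dM_sharp_symTables` — the same for a `SymTables d Lc` record (`SpureSymOf tabs`, `tabs.M j`).
* §4 **`hDg_symTablesAn1`** — THE BINDER `hDg` OF ROOT J VERBATIM (d = 3, an1's tables `symVhSAt (ctr 4 Lc) 3 Lc rfl` ∕ `symHessFFAt (ctr 4 Lc) Lc`,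
  shift `Dsh Lc`, `cE = Lc⁴`, `cVH = −Lc⁸∕2`), for every `cΛ`, `γ`: no `Odd Lc`, no lock, no letter is used.
* §5 `abs_ctGenM_mul_ctGenM_le`, **`locStencil₂_diagK_ctGenM_mul_ctGenM`** (rate `δ∕3`), `ctGenM_symbol_classes`, **`h2_classes_symTablesAn1`** — the
  bounded ∕ `LocStencil₂` classes of the product symbol `(c·E_{κu})·(c′·E_{κ′u′})` over any spread border `B` (ROOT J's `h2`; the `hhb`∕`hhl` shape of
  the comb closed root `SpineRooted.…_of_letters_closed`; sym twin of `SecondOrderZeroCanon.canon_classes`, whose comb generator has finite range —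
  here only the border's decay is used), ready for the (hX2L)-type socket `SecondOrderSplitLoc.loc_diagK_secondSymbol` once `X2s` is instantiated.
Provenance: β sub-cell, unit `b2b-balaban-beta-d1-formalise-leaf-03` gen 17, 2026-08-21 (v1); suppliers BY NAME as listed; no existing file touched.
-/

noncomputable section

open Finset
open scoped BigOperators
open Literature.MathematicalPhysics.QuantumFieldTheory
open Literature.MathematicalPhysics.QuantumFieldTheory.Balaban1983to89
open Literature.MathematicalPhysics.QuantumFieldTheory.Balaban1983to89.Beta
open B12Sec2to5 (l1 l1_nonneg)
open ExpKernelCalculus (MKer Decays BiLoc VertexFamily l1_sub_triangle l1_sub_symm)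
open BalabanCompositeJets (LocStencil₂)
open AveragingContoursRooted (ctr ctrOff ctrOff_mem_box)
open OneStepResolventKernel (Fib LocStencil biLoc_mono decays_mono)
open StepJetData (biLoc_smul)
open SecondOrderResponse (dM)
open Summit.QuantumFields.BalabanUV.Beta.TameKernelCalculus
open Summit.QuantumFields.BalabanUV.Beta.ChartConjugation (conjV)
open Summit.QuantumFields.BalabanUV.Beta.AxialDressingRooted (one_le_of_neZero)
open Summit.QuantumFields.BalabanUV.Beta.BorderedHessian (bhK diagK diagK_apply spr_bhK)
open Summit.QuantumFields.BalabanUV.Beta.VertexReflectionContact (smul_diagK)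
open Summit.QuantumFields.BalabanUV.Beta.E3ContactGenerator (ctGenM abs_ctGenM_le biLoc_diagK_ctGenM locStencil_diagK_ctGenM)
open Summit.QuantumFields.BalabanUV.Beta.SecondOrderSplitLoc (loc_dM_sharp)
open Summit.QuantumFields.BalabanUV.Beta.SymmetrisedStepJets (SymTables Gsym decays_Gsym SpureSymOf locStencil_SpureSymOf)
open Summit.QuantumFields.BalabanUV.Beta.SpineRooted (M1Of SpureRecOf locStencil_SpureRecOf vertexFamily_M1Of)
open Summit.QuantumFields.BalabanUV.Beta.SymShiftedSpread (bhKStepSh spr_bhKStepSh)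
open Summit.QuantumFields.BalabanUV.Beta.RelInvNullShift (spr_add)
open Summit.QuantumFields.BalabanUV.Beta.DshAn1 (Dsh spr_Dsh)
open Summit.QuantumFields.BalabanUV.Beta.SymAveragingHessianCounts (symVhSAt symHessFFAt symVhSAt_hV_ctr symHessFFAt_hH_ctr)

namespace Summit.QuantumFields.BalabanUV.Beta.SymSecondOrderSplitLoc

variable {d : ℕ}

/-! ## §1 The scaled generator family is a local stencil family -/

/-- [folklore] **THE `c`-SCALED DIAGONAL GENERATOR FAMILY IS A LOCAL STENCIL FAMILY** (the `c * ·` spelling of the roots): for a border `B` decaying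
at rate `δ` with constant `C`, `κ u ↦ diagK (p a ↦ c·ctGenM d B α L κ u p a)` is bi-localised at `(u, u)` with constant `|c|·(1 + L^{−(d+1)}·C)`, rate `δ∕2`
(`E3ContactGenerator.locStencil_diagK_ctGenM` read through `VertexReflectionContact.smul_diagK`). -/
theorem locStencil_diagK_mul_ctGenM {B : MKer (d + 1) (Fib d)} {C δ : ℝ} (hB : Decays B C δ) (hδ : 0 ≤ δ) (c : ℝ) (α : Fin (d + 1)) (L : ℕ) :
    LocStencil (fun κ u => diagK fun p a => c * ctGenM d B α L κ u p a) (|c| * (1 + ((L : ℝ) ^ (d + 1))⁻¹ * C)) (δ / 2) := by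
  intro κ u
  show BiLoc (diagK fun p a => c * ctGenM d B α L κ u p a) u u _ _
  rw [← smul_diagK]
  exact biLoc_smul (locStencil_diagK_ctGenM α L hB hδ κ u) c

/-! ## §2 (hDg) in existential currency, generic kernels -/

/-- [folklore] **(hDg) IN CLASS CURRENCY**: for a decaying `K`, spread `𝕄` and `B`, a local stencil family `S`, a first-order vertex family `M` (each at
SOME positive rate) and any scalar `c`, the Lagrangian-chart vertex over the ♯-table `κ u ↦ S κ u + conjV 𝕄 (diagK (c·ctGenM d B α N κ u))` is localised:
`Loc (dM K N S♯ M ν y′)` — leaf-10's `SecondOrderSplitLoc.loc_dM_sharp` at the common rate `min(δ_K, δ_𝕄, δ_S, δ_M, δ_B∕2)`. -/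
theorem loc_dM_sharp_of_classes {N : ℕ} [NeZero N] {K 𝕄 B : MKer (d + 1) (Fib d)} (hK : ∃ δ C : ℝ, 0 < δ ∧ 0 ≤ C ∧ Decays K C δ) (h𝕄 : Spr 𝕄)
    (hB : Spr B) {S : Fin (d + 1) → (Fin (d + 1) → ℤ) → MKer (d + 1) (Fib d)} (hS : ∃ Cs δ : ℝ, 0 < δ ∧ LocStencil S Cs δ)
    {M : Fin (d + 1) → (Fin (d + 1) → ℤ) → MKer (d + 1) (Fib d)} (hM : ∃ CM δ : ℝ, 0 < δ ∧ VertexFamily M N CM δ)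
    (c : ℝ) (α ν : Fin (d + 1)) (y' : Fin (d + 1) → ℤ) :
    Loc (dM K N (fun κ u => S κ u + conjV 𝕄 (diagK fun p a => c * ctGenM d B α N κ u p a)) M ν y') := by
  obtain ⟨δK, C, hδK, hC, hKd⟩ := hK
  obtain ⟨C𝕄, δ𝕄, hδ𝕄, h𝕄d⟩ := h𝕄
  obtain ⟨CB, δB, hδB, hBd⟩ := hB
  obtain ⟨Cs, δs, hδs, hSl⟩ := hS
  obtain ⟨CM, δM, hδM, hMl⟩ := hM
  -- one common rate
  set m : ℝ := min (min (min δK δ𝕄) (min δs δM)) (δB / 2) with hm_def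
  have hm : 0 < m := lt_min (lt_min (lt_min hδK hδ𝕄) (lt_min hδs hδM)) (half_pos hδB)
  have hmK : m ≤ δK := (min_le_left _ _).trans ((min_le_left _ _).trans (min_le_left _ _))
  have hm𝕄 : m ≤ δ𝕄 := (min_le_left _ _).trans ((min_le_left _ _).trans (min_le_right _ _))
  have hms : m ≤ δs := (min_le_left _ _).trans ((min_le_right _ _).trans (min_le_left _ _))
  have hmM : m ≤ δM := (min_le_left _ _).trans ((min_le_right _ _).trans (min_le_right _ _))
  have hmB : m ≤ δB / 2 := min_le_right _ _
  -- the generator family at rate `δB / 2`, lowered to `m`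
  have hg : LocStencil (fun κ u => diagK fun p a => c * ctGenM d B α N κ u p a) (|(|c| * (1 + ((N : ℝ) ^ (d + 1))⁻¹ * CB))|) m :=
    fun κ u => biLoc_of_le (locStencil_diagK_mul_ctGenM hBd hδB.le c α N κ u) hmB
  exact loc_dM_sharp (N := N) (decays_mono hKd hC le_rfl hmK) hC (decays_of_le h𝕄d hm𝕄) hm (Cs := |Cs|) (fun κ u => biLoc_of_le (hSl κ u) hms)
    (CM := |CM|) (fun μ w => biLoc_of_le (hMl μ w) hmM) hg ν y'

/-! ## §3 (hDg) at the (0.4) literal: `Gsym`, the shifted spread, the recursive pure stencils, the multiplier tables -/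

/-- [folklore] **(hDg) AT THE (0.4) LITERAL, ANY FIRST-ORDER TABLES `(V, H)` OF CLASSES (LV)(LH), ANY SPREAD SHIFT `D`**:
`Loc (dM (Gsym Lc j) Lc (κ u ↦ SpureRecOf d Lc V H (Gsym Lc) cE cVH cΛ j κ u + conjV (bhKStepSh d Lc D j) (diagK (γ_j·ctGenM d (bhK Lc + D) α Lc κ u))) (M1Of d Lc H cΛ j) ν y′)`
— every level `j`, axis `α`, bond `(ν, y′)`, any `γ`; no `Odd Lc`, no lock, no letter. -/
theorem loc_dM_sharp_sym {Lc : ℕ} [NeZero Lc] {V H : Fin (d + 1) → (Fin (d + 1) → ℤ) → MKer (d + 1) (Fib d)}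
    (hV : ∀ δ : ℝ, 0 ≤ δ → ∃ C : ℝ, LocStencil V C δ) (hH : ∀ δ : ℝ, 0 ≤ δ → ∃ C : ℝ, VertexFamily H Lc C δ)
    {D : MKer (d + 1) (Fib d)} (hD : Spr D) (cE cVH cΛ : ℝ) (γ : ℕ → ℝ) (j : ℕ) (α ν : Fin (d + 1)) (y' : Fin (d + 1) → ℤ) :
    Loc (dM (Gsym (d := d) Lc j) Lc
      (fun κ u => SpureRecOf d Lc V H (Gsym Lc) cE cVH cΛ j κ u + conjV (bhKStepSh d Lc D j) (diagK fun p c => γ j * ctGenM d (bhK Lc + D) α Lc κ u p c))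
      (M1Of d Lc H cΛ j) ν y') := by
  have hL1 : 1 ≤ Lc := one_le_of_neZero Lc
  obtain ⟨C1, hH1⟩ := hH 1 zero_le_one
  exact loc_dM_sharp_of_classes (decays_Gsym Lc j) (spr_bhKStepSh hD j) (spr_add (spr_bhK hL1) hD)
    (locStencil_SpureRecOf hL1 hV hH (decays_Gsym Lc) cE cVH cΛ j) ⟨_, 1, one_pos, vertexFamily_M1Of hH1 cΛ j⟩ (γ j) α ν y'

/-- [folklore] **(hDg) FOR ANY `SymTables d Lc` RECORD** (pure members `SpureSymOf tabs`, multiplier tables `tabs.M j`), any spread shift `D`. -/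
theorem loc_dM_sharp_symTables {Lc : ℕ} [NeZero Lc] (tabs : SymTables d Lc) {D : MKer (d + 1) (Fib d)} (hD : Spr D) (cE cVH cΛ : ℝ) (γ : ℕ → ℝ)
    (j : ℕ) (α ν : Fin (d + 1)) (y' : Fin (d + 1) → ℤ) :
    Loc (dM (Gsym (d := d) Lc j) Lc
      (fun κ u => SpureSymOf tabs cE cVH cΛ j κ u + conjV (bhKStepSh d Lc D j) (diagK fun p c => γ j * ctGenM d (bhK Lc + D) α Lc κ u p c))
      (tabs.M j) ν y') :=
  loc_dM_sharp_of_classes (decays_Gsym Lc j) (spr_bhKStepSh hD j) (spr_add (spr_bhK (one_le_of_neZero Lc)) hD)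
    (locStencil_SpureSymOf tabs cE cVH cΛ j) (tabs.hM j) (γ j) α ν y'

/-! ## §4 THE BINDER `hDg` OF ROOT J, VERBATIM -/

/-- [folklore] **THE LOCALISATION BINDER `hDg` OF THE LITERAL ROOT (ROOT J `RowD1JointEndSymReflTablesAn1S2MWVB`, tree l.124–125) IS A THEOREM**,
for every `cΛ` and every `γ` (an1's tables `symVhSAt (ctr 4 Lc) 3 Lc rfl` ∕ `symHessFFAt (ctr 4 Lc) Lc` of classes (LV)(LH) by
`symVhSAt_hV_ctr` ∕ `symHessFFAt_hH_ctr`; shift `Dsh Lc` spread by `spr_Dsh`). -/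
theorem hDg_symTablesAn1 {Lc : ℕ} [NeZero Lc] (cΛ : ℝ) (γ : ℕ → ℝ) :
    ∀ (j : ℕ) (α ν : Fin 4) (y' : Fin 4 → ℤ),
      Loc (dM (Gsym (d := 3) Lc j) Lc (fun κ u => SpureRecOf 3 Lc (symVhSAt (ctr 4 Lc) 3 Lc rfl) (symHessFFAt (ctr 4 Lc) Lc) (Gsym Lc) ((Lc : ℝ) ^ 4) (-((Lc : ℝ) ^ 8 / 2)) cΛ j κ u + conjV (bhKStepSh 3 Lc (Dsh Lc) j) (diagK fun p c => γ j * ctGenM 3 (bhK Lc + Dsh Lc) α Lc κ u p c)) (M1Of 3 Lc (symHessFFAt (ctr 4 Lc) Lc) cΛ j) ν y') :=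
  fun j α ν y' =>
    loc_dM_sharp_sym (d := 3) (symVhSAt_hV_ctr (d := 3) (one_le_of_neZero Lc)) (symHessFFAt_hH_ctr (d := 3) (one_le_of_neZero Lc))
      (spr_Dsh (one_le_of_neZero Lc)) ((Lc : ℝ) ^ 4) (-((Lc : ℝ) ^ 8 / 2)) cΛ γ j α ν y'

/-! ## §5 The classes of the literal's second re-charting symbol `(c·E_{κu})·(c′·E_{κ′u′})` (the `h2` of ROOT J) -/

/-- [folklore] **THE PRODUCT SYMBOL IS BOUNDED**: `|(c·E_{κu}(p,a))·(c′·E_{κ′u′}(p,a))| ≤ |c|·|c′|·(1 + L^{−(d+1)}·C)²` for a border `B` decaying with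
constant `C` (`E3ContactGenerator.abs_ctGenM_le` twice). -/
theorem abs_ctGenM_mul_ctGenM_le {B : MKer (d + 1) (Fib d)} {C δ : ℝ} (hB : Decays B C δ) (hδ : 0 ≤ δ) (c c' : ℝ) (α : Fin (d + 1)) (L : ℕ)
    (κ : Fin (d + 1)) (u : Fin (d + 1) → ℤ) (κ' : Fin (d + 1)) (u' : Fin (d + 1) → ℤ) (p : Fin (d + 1) → ℤ) (a : Fib d) :
    |(c * ctGenM d B α L κ u p a) * (c' * ctGenM d B α L κ' u' p a)| ≤ |c| * |c'| * (1 + ((L : ℝ) ^ (d + 1))⁻¹ * C) ^ 2 := by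
  have h1 := abs_ctGenM_le α L κ u hB hδ p a
  have h2 := abs_ctGenM_le α L κ' u' hB hδ p a
  have h0 : 0 ≤ 1 + ((L : ℝ) ^ (d + 1))⁻¹ * C := (abs_nonneg _).trans h1
  rw [abs_mul, abs_mul, abs_mul, sq]
  calc |c| * |ctGenM d B α L κ u p a| * (|c'| * |ctGenM d B α L κ' u' p a|)
      ≤ |c| * (1 + ((L : ℝ) ^ (d + 1))⁻¹ * C) * (|c'| * (1 + ((L : ℝ) ^ (d + 1))⁻¹ * C)) :=
        mul_le_mul (mul_le_mul_of_nonneg_left h1 (abs_nonneg c)) (mul_le_mul_of_nonneg_left h2 (abs_nonneg c')) (by positivity) (by positivity)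
    _ = |c| * |c'| * ((1 + ((L : ℝ) ^ (d + 1))⁻¹ * C) * (1 + ((L : ℝ) ^ (d + 1))⁻¹ * C)) := by ring

/-- [folklore] **THE PRODUCT SYMBOL'S DIAGONAL KERNEL IS A `LocStencil₂` FAMILY**: for a border `B` decaying at rate `δ ≥ 0` with constant `C`,
`LocStencil₂ (κ u κ′ u′ ↦ diagK ((c·E_{κu})·(c′·E_{κ′u′}))) (|c|·|c′|·(1 + L^{−(d+1)}·C)²) (δ∕3)` — both factors are bi-localised at their jet bonds at rate
`δ∕2` (`E3ContactGenerator.biLoc_diagK_ctGenM`), and on the diagonal `x = y` the triangle inequality `|u′−u|₁ ≤ |x−u′|₁ + |x−u|₁` trades one third of the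
rate for the bond-separation factor the class `BalabanCompositeJets.LocStencil₂` asks for (the sym twin of `SecondOrderZeroCanon.locStencil₂_diagK_ctGen_mul_ctGen`,
whose comb generator has finite range). -/
theorem locStencil₂_diagK_ctGenM_mul_ctGenM {B : MKer (d + 1) (Fib d)} {C δ : ℝ} (hB : Decays B C δ) (hδ : 0 ≤ δ) (c c' : ℝ) (α : Fin (d + 1))
    (L : ℕ) :
    LocStencil₂ (fun κ u κ' u' => diagK fun p a => (c * ctGenM d B α L κ u p a) * (c' * ctGenM d B α L κ' u' p a))
      (|c| * |c'| * (1 + ((L : ℝ) ^ (d + 1))⁻¹ * C) ^ 2) (δ / 3) := by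
  classical
  intro κ u κ' u' x y a b
  have hK0 : 0 ≤ 1 + ((L : ℝ) ^ (d + 1))⁻¹ * C := (abs_nonneg _).trans (abs_ctGenM_le α L κ u hB hδ x a)
  have hg := biLoc_diagK_ctGenM α L κ u hB hδ x y a b
  have hg' := biLoc_diagK_ctGenM α L κ' u' hB hδ x y a b
  show |diagK (fun p a => (c * ctGenM d B α L κ u p a) * (c' * ctGenM d B α L κ' u' p a)) x y a b| ≤
    |c| * |c'| * (1 + ((L : ℝ) ^ (d + 1))⁻¹ * C) ^ 2 * Real.exp (-(δ / 3) * l1 (u' - u)) * Real.exp (-(δ / 3) * (l1 (x - u) + l1 (y - u)))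
  rw [diagK_apply] at hg hg' ⊢
  split_ifs at hg hg' ⊢ with h
  · obtain ⟨rfl, rfl⟩ := h
    have htri : l1 (u' - u) ≤ l1 (x - u') + l1 (x - u) := by
      have h3 := l1_sub_triangle u' x u
      rwa [l1_sub_symm u' x] at h3
    have ha : 0 ≤ l1 (x - u) := l1_nonneg _
    have hb : 0 ≤ l1 (x - u') := l1_nonneg _
    have h3 : 0 ≤ δ / 3 := by positivity
    have hlin : -(δ / 2) * (l1 (x - u) + l1 (x - u)) + -(δ / 2) * (l1 (x - u') + l1 (x - u')) ≤
        -(δ / 3) * l1 (u' - u) + -(δ / 3) * (l1 (x - u) + l1 (x - u)) := by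
      have h4 := mul_le_mul_of_nonneg_left htri h3
      nlinarith
    have hexp : Real.exp (-(δ / 2) * (l1 (x - u) + l1 (x - u))) * Real.exp (-(δ / 2) * (l1 (x - u') + l1 (x - u'))) ≤
        Real.exp (-(δ / 3) * l1 (u' - u)) * Real.exp (-(δ / 3) * (l1 (x - u) + l1 (x - u))) := by
      rw [← Real.exp_add, ← Real.exp_add]
      exact Real.exp_le_exp.mpr hlin
    rw [abs_mul, abs_mul, abs_mul, sq]
    calc |c| * |ctGenM d B α L κ u x a| * (|c'| * |ctGenM d B α L κ' u' x a|)
        = (|c| * |c'|) * (|ctGenM d B α L κ u x a| * |ctGenM d B α L κ' u' x a|) := by ring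
      _ ≤ (|c| * |c'|) * (((1 + ((L : ℝ) ^ (d + 1))⁻¹ * C) * Real.exp (-(δ / 2) * (l1 (x - u) + l1 (x - u)))) *
            ((1 + ((L : ℝ) ^ (d + 1))⁻¹ * C) * Real.exp (-(δ / 2) * (l1 (x - u') + l1 (x - u'))))) :=
          mul_le_mul_of_nonneg_left (mul_le_mul hg hg' (abs_nonneg _) (by positivity)) (by positivity)
      _ = (|c| * |c'|) * ((1 + ((L : ℝ) ^ (d + 1))⁻¹ * C) * (1 + ((L : ℝ) ^ (d + 1))⁻¹ * C)) *
            (Real.exp (-(δ / 2) * (l1 (x - u) + l1 (x - u))) * Real.exp (-(δ / 2) * (l1 (x - u') + l1 (x - u')))) := by ring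
      _ ≤ (|c| * |c'|) * ((1 + ((L : ℝ) ^ (d + 1))⁻¹ * C) * (1 + ((L : ℝ) ^ (d + 1))⁻¹ * C)) *
            (Real.exp (-(δ / 3) * l1 (u' - u)) * Real.exp (-(δ / 3) * (l1 (x - u) + l1 (x - u)))) :=
          mul_le_mul_of_nonneg_left hexp (by positivity)
      _ = _ := by ring
  · rw [abs_zero]; positivity

/-- [folklore] The `∃`-form of the two classes (bounded ∕ `LocStencil₂` at SOME positive rate) for the symbol family
`j α κ u κ′ u′ p a ↦ (c j·E_{κu}(p,a))·(c j·E_{κ′u′}(p,a))` over any SPREAD border `B` — the shape of the letter-class binders `hhb`∕`hhl` of the comb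
closed root `SpineRooted.…_of_letters_closed`, now for the border-reading generator (the sym twin of `SecondOrderZeroCanon.canon_classes`). -/
theorem ctGenM_symbol_classes {B : MKer (d + 1) (Fib d)} (hB : Spr B) (c : ℕ → ℝ) (j : ℕ) (α : Fin (d + 1)) (L : ℕ) :
    (∃ Bh : ℝ, ∀ (κ : Fin (d + 1)) (u : Fin (d + 1) → ℤ) (κ' : Fin (d + 1)) (u' : Fin (d + 1) → ℤ) (p : Fin (d + 1) → ℤ) (a : Fib d),
        |(c j * ctGenM d B α L κ u p a) * (c j * ctGenM d B α L κ' u' p a)| ≤ Bh) ∧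
      ∃ Ch mh : ℝ, 0 < mh ∧
        LocStencil₂ (fun κ u κ' u' => diagK fun p a => (c j * ctGenM d B α L κ u p a) * (c j * ctGenM d B α L κ' u' p a)) Ch mh := by
  obtain ⟨CB, δB, hδB, hBd⟩ := hB
  exact ⟨⟨_, abs_ctGenM_mul_ctGenM_le hBd hδB.le (c j) (c j) α L⟩,
    ⟨_, δB / 3, by positivity, locStencil₂_diagK_ctGenM_mul_ctGenM hBd hδB.le (c j) (c j) α L⟩⟩

/-- [folklore] **THE CLASSES OF ROOT J's `h2`** (`B := bhK Lc + Dsh Lc`, `d = 3`, `L := Lc`; `spr_add (spr_bhK) (spr_Dsh)`), every `γ`, `j`, `α`. -/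
theorem h2_classes_symTablesAn1 {Lc : ℕ} [NeZero Lc] (γ : ℕ → ℝ) (j : ℕ) (α : Fin 4) :
    (∃ Bh : ℝ, ∀ (κ : Fin 4) (u : Fin 4 → ℤ) (κ' : Fin 4) (u' : Fin 4 → ℤ) (p : Fin 4 → ℤ) (a : Fib 3),
        |(γ j * ctGenM 3 (bhK Lc + Dsh Lc) α Lc κ u p a) * (γ j * ctGenM 3 (bhK Lc + Dsh Lc) α Lc κ' u' p a)| ≤ Bh) ∧
      ∃ Ch mh : ℝ, 0 < mh ∧
        LocStencil₂ (fun κ u κ' u' => diagK fun p a => (γ j * ctGenM 3 (bhK Lc + Dsh Lc) α Lc κ u p a) * (γ j * ctGenM 3 (bhK Lc + Dsh Lc) α Lc κ' u' p a))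
          Ch mh :=
  ctGenM_symbol_classes (spr_add (spr_bhK (one_le_of_neZero Lc)) (spr_Dsh (one_le_of_neZero Lc))) γ j α Lc

end Summit.QuantumFields.BalabanUV.Beta.SymSecondOrderSplitLoc

end
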